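import Mathlib
import Literature.MathematicalPhysics.QuantumFieldTheory.Balaban1983to89.B6
import Literature.MathematicalPhysics.QuantumFieldTheory.Balaban1983to89.B6RandomWalk

/-!
# `Balaban1983to89.B6Cor28` — [Balaban1984PropagatorsII] Corollary 2.8 (p. 249): the UNPRINTED composition step
"Prop. 2.6 ∘ Prop. 2.7 via Lemma 2.1" KERNEL-CHECKED as an abstract multiscale-kernel lemma

CITATION HEADER (lean-in-tree rule 2026-08-18).  Source: T. Bałaban, *Propagators and renormalization transformations
for lattice gauge theories. II*, Commun. Math. Phys. **96**, 223–250 (1984) [Balaban1984PropagatorsII] (cell paper B6;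
held: `paper:balaban1984-cmp96-propagators-rt-ii`; journal page = PDF page + 222; quotations below are read from the
page renders pp. 234, 238, 246, 247, 249).  Satellite of the sibling module `…Balaban1983to89.B6` (unit r1 / sub-cell
b06) and of `…B6RandomWalk` (unit pv08), which it imports and does not modify; surge node T03.7 "sharpen" (Prop. 2.7 + Cor. 2.8), unit
`b2b-balaban-pv01`; REVISION v2 (same unit, surge node T03.3 "sharpen", Prop. 2.3 p. 238) appends the kernel-check
of the model computation (2.88) itself (section "REVISION v2" at the end; item (5) below).

WHAT THE PAPER PRINTS.  Prop. 2.7 (p. 249): *"The operator (QGQ*)^{−1} is given by the convergent expansions of the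
form (2.86), and it satisfies the bound |(QGQ*)^{−1}(b, b′)| ≤ O(1)(L^jη)^{−2}(L^{j′}η)^{−d} e^{−½δ₄d(b,b′)}, b ∈ Λ_j,
b′ ∈ Λ_{j′}. (2.149)"*; then: *"We will apply the results obtained until now to many different problems. At first
let us consider the operator H. We have **Corollary 2.8.** A kernel of the operator H, (HB)(b) = Σ_{c∈𝔅}
(L^{j(c)}η)^d H(b, c)B(c), (2.150) satisfies the inequality |H(b, c)|, |(∇H)(b, c)|, ‖(ζ∇H)(·, c)‖_α ≤ O(1)[1,
(L^jη)^{−1}, (L^jη)^{−1−α}(‖ζ‖^ξ_α + |ζ|)](L^{j′}η)^{−d} e^{−δ₅d(y,c₋)}, (1.151)[sic] b ∈ Δ(y) or supp ζ ⊂ Δ(y),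
y ∈ Λ_j, c₋ ∈ Λ_{j′}. This Corollary and Proposition 2.6 are our main technical results."*  NO PROOF of Cor. 2.8 is
printed.  The evident route (cell GAPS.md C-B6-5, sub-cell b06: *"Cor. 2.8 = Prop. 2.6 ∘ Prop. 2.7 via Lemma 2.1
(scale-mismatch powers absorbed as in (2.88))"*) is: H = GQ*(QGQ*)^{−1} ((2.130) p. 246, *"Thus this operator
coincides with the operator introduced in Sect. D"*), so the (2.150)-kernel of H is the (L^{j(c′)}η)^d-weighted
composition of the kernel of GQ* — bounded through (2.136) of Prop. 2.6 (p. 247: *"|(GJ)(x)|, |(∇GJ)(x)|, |(G∇*J)(x)|,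
|(ΔGJ)(x)| ≤ O(1)[(L^jη)², L^jη, L^jη, 1] e^{−δ₃d(y,y′)}|J| (2.136) for x ∈ Δ(y), y ∈ Λ_j, supp J ⊂ Δ(y′)"*) —
with the kernel (2.149), the sum over the intermediate point c′ ∈ 𝔅 being done exactly as in the printed model
computation (2.88) p. 238 (*"≤ O(1) Σ_{y₁,y₂∈𝔅} L^jη e^{−½δ₀d(y,y₁)}(L^{j₁}η)^{−4} e^{−½δ₁d(y₁,y₂)}(L^{j₂}η)^{−d}
e^{−½δ₀d(y₂,y′)} L^{j′}η ≤ O(1)(L^jη)^{−2}(L^{j′}η)^{−d} e^{−δ₂d(y,y′)}, (2.88) where … δ₂ is determined by δ₀,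
δ₁"*): mismatched scaling powers of the intermediate point are absorbed with Lemma 2.1 (2.60) (p. 234:
*"e^{−αδ₀d(y,y′)} ≤ e^{−αδ₀RM max{|j−j′|−1,0}}, y ∈ Λ_j, y′ ∈ Λ_{j′}, (2.60)"*) and the remaining exponentials are
convolved with (2.63) (*"Σ_{y₁,…,y_{n−1}∈𝔅} e^{−δ₀d(y,y₁)}·…·e^{−δ₀d(y_{n−1},y′)} ≤ c₁(α)^n e^{−(1−α)δ₀d(y,y′)}.
(2.63)"*).

WHAT IS REPRODUCED HERE (kernel-checked, every analytic input an explicit hypothesis quoting its printed source):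
(1) the (2.150)-calculus: operators act by `applyKer` ((HB)(b) = Σ_c ℓ(c)^d H(b,c)B(c)) and the kernel of a product is
the weighted composition `compKer` (`applyKer_comp`, pure algebra); (2) `comp_bound`: if |K₁(b,c′)| ≤ C₁ ℓ(b)^p
ℓ(c′)^{−d} e^{−δd(b,c′)} (the kernel form of (2.136)/(2.137) for J concentrated at c′: p = 2, 1, 1−α), |K₂(c′,c)| ≤ C₂
ℓ(c′)^{−2} ℓ(c)^{−d} e^{−δ′d(c′,c)} ((2.149)), the (2.88)-type absorption ℓ(b)² ℓ(c′)^{−2} e^{−εd(b,c′)} ≤ A and the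
(2.63)-type convolution Σ_{c′} e^{−δ₀d(b,c′)} e^{−δ₀d(c′,c)} ≤ C_c e^{−θd(b,c)} hold with δ ≥ δ₀ + ε, δ′ ≥ δ₀, then
|Σ_{c′} ℓ(c′)^d K₁(b,c′)K₂(c′,c)| ≤ C₁C₂AC_c ℓ(b)^{p−2} ℓ(c)^{−d} e^{−θd(b,c)} — i.e. the three scaling entries
[1, (L^jη)^{−1}, (L^jη)^{−1−α}] of Cor. 2.8 with δ₅ = θ = (1−α)δ₀, δ₀ ≤ min(δ₃ − ε, ½δ₄), and O(1) = C₁C₂AC_c explicit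
(`cor28_scaling_entries`); (3) `absorb_of_260`: the absorption constant A = L² FOLLOWS from (2.60) once
e^{εRM} ≥ L² (ε = αδ₀) — the quantitative content of "M sufficiently large" at this step (Prop. 2.2 p. 234 prints *"If
we have (2.1), (2.2) and M is sufficiently large"*; Props. 2.6/2.7/Cor. 2.8 of `…B6` carry `M₁ ≤ M`); (4)
`cor28_entries_of_lemma21`: over the carrier `B6.Geometry`, the absorption AND the convolution are DISCHARGED from the
tree's typed Lemma 2.1 (`B6.Lemma21Printed` (2.60)–(2.61), with (2.63) kernel-derived in `…B6RandomWalk` (unit pv08)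
from (2.61) + the triangle inequality (2.54)), so that the displayed first conjunct of `B6.Cor28Printed` (entries |H|,
|∇H|) follows for one geometry from ONLY the two kernel bounds + the printed side conditions (0 < α < 1, (2.59),
(2.1)–(2.2)) + `1 ≤ L`, `0 < η`, `d ≥ 0`, `L² ≤ e^{αδ₀RM}`, with δ₅ = (1−α)δ₀ for any δ₀ ≥ 0 with (1+α)δ₀ ≤ δ₃,
δ₀ ≤ ½δ₄, and O(1) = C₁C₂L²c₁(α)²; (5) [REVISION v2, node T03.3] the SECOND inequality of the printed model
computation (2.88) p. 238 itself — three kernels, two intermediate points, powers ℓ(y)¹ℓ(y₁)^{−4}ℓ(y₂)^{−d}ℓ(y′)¹ ↦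
ℓ(y)^{−2}ℓ(y′)^{−d} — KERNEL-CHECKED (`ineq288_kernel`) from scale transfers in both directions DERIVED from (2.60)
under `L^{|q|} ≤ e^{εRM}` (`transfer_of_260`), the triangle inequality (2.54) and (2.63) with n = 3, and ASSEMBLED over
`B6.Geometry` from the tree's typed Lemma 2.1 (`ineq288_of_lemma21`, `ineq288_printed_of_lemma21`): "δ₂ is
determined by δ₀, δ₁" made explicit as δ₂ = (1−α)δ for any δ ≥ 0 with (1+2α)δ ≤ ½δ₀, (1+α)δ ≤ ½δ₁, under the
largeness L⁴, L^d, L ≤ e^{αδRM}, with O(1) = C₁C₂C₃·L⁴·L^d·L·c₁(α)³.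
WHAT IS *NOT* REPRODUCED OR ASSERTED: (2.136)/(2.137), (2.149), (2.60), (2.63) themselves (hypotheses only); the
identification of the kernel of GQ* from (2.136) with J = Q*(indicator of c′) (|J| = 1, supp J ⊂ Δ(c′) — the
reader's, cell GAPS.md G-pv01-3 (i)); the sup over b ∈ Δ(y) and the Hölder-norm bookkeeping of the third entry (its
factor (‖ζ‖^ξ_α + |ζ|) rides inside C₁); for (2.88): its FIRST inequality (the kernel forms of Prop. 2.2's entries
∇G′, G′∇* with λ = Q′*δ_{y₁}, |λ| = O(1), and (2.87) — three kernel-bound hypotheses) and the Neumann bookkeeping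
(2.86) ⇒ (2.87) of Prop. 2.3 (node T03.2, unit pv08).  NOTHING of the series is asserted; value = typed skeleton +
located gaps, NOT summit progress.  Companion rows: cell `GAPS.md` G-pv01-3, G-pv01-4, `DIVERGENCE.md` D-pv01.3,
D-pv01.4.
-/

namespace Literature.MathematicalPhysics.QuantumFieldTheory.Balaban1983to89.B6Cor28

open Real Finset

/-! ## The (2.150)-calculus of kernels on the multiscale set 𝔅 -/

variable {S : Type*} [Fintype S]

/-- (2.150) p. 249, verbatim: *"A kernel of the operator H, (HB)(b) = Σ_{c∈𝔅} (L^{j(c)}η)^d H(b, c)B(c), (2.150)"* —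
an operator on functions on the (finite) multiscale set 𝔅 acts through its kernel with the weight `ℓ(c)^d`,
`ℓ(c) = L^{j(c)}η`. [cite: Balaban1984PropagatorsII, (2.150) p.249] -/
noncomputable def applyKer (ℓ : S → ℝ) (d : ℕ) (K : S → S → ℝ) (B : S → ℝ) (b : S) : ℝ :=
  ∑ c, ℓ c ^ (d : ℝ) * K b c * B c

/-- The (2.150)-kernel of a product of two operators given by (2.150)-kernels `K₁`, `K₂`: the weighted composition
`Σ_{c′∈𝔅} ℓ(c′)^d K₁(b,c′) K₂(c′,c)` (how the kernel of H = GQ*(QGQ*)^{−1}, (2.130) p. 246, is assembled from the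
kernels of GQ* and (QGQ*)^{−1}; the one-intermediate-point case of the printed model sum (2.88) p. 238). [folklore] -/
noncomputable def compKer (ℓ : S → ℝ) (d : ℕ) (K₁ K₂ : S → S → ℝ) (b c : S) : ℝ :=
  ∑ c', ℓ c' ^ (d : ℝ) * K₁ b c' * K₂ c' c

/-- The kernel of the composed operator IS the weighted composition of the kernels (exchange of two finite sums).
[folklore] -/
theorem applyKer_comp (ℓ : S → ℝ) (d : ℕ) (K₁ K₂ : S → S → ℝ) (B : S → ℝ) (b : S) :
    applyKer ℓ d K₁ (applyKer ℓ d K₂ B) b = applyKer ℓ d (compKer ℓ d K₁ K₂) B b := by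
  unfold applyKer compKer
  simp only [Finset.mul_sum, Finset.sum_mul]
  rw [Finset.sum_comm]
  refine Finset.sum_congr rfl fun c _ => Finset.sum_congr rfl fun c' _ => ?_
  ring

/-! ## The located analytic inputs, as named hypotheses -/

/-- KERNEL FORM of (2.136)/(2.137) (Prop. 2.6, p. 247) for the operator GQ*, J concentrated at the point c′ of 𝔅
(the reader's identification, cell GAPS.md G-pv01-3 (i): J = Q*(indicator of c′), |J| = 1, supp J inside Δ(c′);
the weight (L^{j(c′)}η)^d of the c′-sum in (2.150) appears as ℓ(c′)^{−d} on the kernel): `|K₁(b,c′)| ≤ C₁ ℓ(b)^p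
ℓ(c′)^{−d} e^{−δ d(b,c′)}` with `p = 2` for |H|, `p = 1` for |∇H| (entries (L^jη)², L^jη of (2.136)) and `p = 1 − α`
for the Hölder entry ((2.137), the factor (‖ζ‖^ξ_α + |ζ|) inside `C₁`), `δ = δ₃`.  Hypothesis only. [cite: Balaban1984PropagatorsII, (2.136)–(2.137) p.247] -/
def KerBound136 (ℓ : S → ℝ) (dist : S → S → ℝ) (d : ℕ) (K₁ : S → S → ℝ) (p C₁ δ : ℝ) : Prop :=
  ∀ b c', |K₁ b c'| ≤ C₁ * ℓ b ^ p * ℓ c' ^ (-(d : ℝ)) * Real.exp (-(δ * dist b c'))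

/-- **(2.149)** (Prop. 2.7, p. 249), verbatim shape: *"|(QGQ*)^{−1}(b, b′)| ≤ O(1)(L^jη)^{−2}(L^{j′}η)^{−d}
e^{−½δ₄d(b,b′)}, b ∈ Λ_j, b′ ∈ Λ_{j′}"* — `|K₂(c′,c)| ≤ C₂ ℓ(c′)^{−2} ℓ(c)^{−d} e^{−δ′ d(c′,c)}`, `δ′ = ½δ₄`.
Hypothesis only (= the kernel clause of `B6.Prop27Printed` for one geometry). [cite: Balaban1984PropagatorsII, Prop. 2.7 (2.149) p.249] -/
def KerBound149 (ℓ : S → ℝ) (dist : S → S → ℝ) (d : ℕ) (K₂ : S → S → ℝ) (C₂ δ' : ℝ) : Prop :=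
  ∀ c' c, |K₂ c' c| ≤ C₂ * ℓ c' ^ (-(2 : ℝ)) * ℓ c ^ (-(d : ℝ)) * Real.exp (-(δ' * dist c' c))

/-- The (2.88)-type ABSORPTION of mismatched scaling powers of the intermediate point (p. 238: in (2.88) the powers
L^jη (L^{j₁}η)^{−4} L^{j′}η of three different points become (L^jη)^{−2}; *"δ₂ is determined by δ₀, δ₁"*): a part
`ε` of the decay rate pays for `(ℓ(b)/ℓ(c′))²`.  Derived from (2.60) under `e^{εRM} ≥ L²` in `absorb_of_260` below;
here a named hypothesis. [cite: Balaban1984PropagatorsII, (2.88) p.238] -/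
def ScaleAbsorb (ℓ : S → ℝ) (dist : S → S → ℝ) (ε A : ℝ) : Prop :=
  ∀ b c', ℓ b ^ (2 : ℝ) * ℓ c' ^ (-(2 : ℝ)) * Real.exp (-(ε * dist b c')) ≤ A

/-- **(2.63)** of Lemma 2.1 (p. 234) with one intermediate point (n = 2), verbatim shape: *"Σ_{y₁,…,y_{n−1}∈𝔅}
e^{−δ₀d(y,y₁)}·…·e^{−δ₀d(y_{n−1},y′)} ≤ c₁(α)^n e^{−(1−α)δ₀d(y,y′)}. (2.63)"* — `Σ_{c′} e^{−δ₀d(b,c′)} e^{−δ₀d(c′,c)}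
≤ C_c e^{−θ d(b,c)}` (`C_c = c₁(α)²`, `θ = (1−α)δ₀`).  Hypothesis only (Lemma 2.1 is `B6.Lemma21Printed`, which
types (2.60)–(2.61); (2.63) is its printed consequence). [cite: Balaban1984PropagatorsII, Lemma 2.1 (2.63) p.234] -/
def Conv263 (dist : S → S → ℝ) (δ₀ Cc θ : ℝ) : Prop :=
  ∀ b c, ∑ c', Real.exp (-(δ₀ * dist b c')) * Real.exp (-(δ₀ * dist c' c)) ≤ Cc * Real.exp (-(θ * dist b c))

/-! ## The composition bound -/

/-- Splitting off a part of an exponential decay factor: `e^{−δt} ≤ e^{−εt} e^{−δ₀t}` for `δ₀ + ε ≤ δ`, `t ≥ 0`.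
[folklore] -/
theorem exp_split_le (δ ε δ₀ t : ℝ) (hδ : δ₀ + ε ≤ δ) (ht : 0 ≤ t) :
    Real.exp (-(δ * t)) ≤ Real.exp (-(ε * t)) * Real.exp (-(δ₀ * t)) := by
  rw [← Real.exp_add]
  apply Real.exp_le_exp.mpr
  nlinarith [mul_le_mul_of_nonneg_right hδ ht]

/-- Weakening an exponential decay rate: `e^{−δ′t} ≤ e^{−δ₀t}` for `δ₀ ≤ δ′`, `t ≥ 0`. [folklore] -/
theorem exp_weaken_le (δ' δ₀ t : ℝ) (hδ : δ₀ ≤ δ') (ht : 0 ≤ t) :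
    Real.exp (-(δ' * t)) ≤ Real.exp (-(δ₀ * t)) := by
  apply Real.exp_le_exp.mpr
  nlinarith [mul_le_mul_of_nonneg_right hδ ht]

/-- **The composition step behind Corollary 2.8, kernel-checked** (the route the paper leaves unprinted; model:
(2.88) p. 238).  Over a finite multiscale set with lengths `ℓ > 0` and a distance `d ≥ 0`: the kernel bound of
(2.136)/(2.137)-type for `K₁` (power `p` of `ℓ(b)`), the kernel bound (2.149) for `K₂`, the (2.88)-type absorption
with constant `A` and the (2.63)-type convolution with constant `C_c` and rate `θ` give, for `δ ≥ δ₀ + ε` and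
`δ′ ≥ δ₀`, `|Σ_{c′} ℓ(c′)^d K₁(b,c′) K₂(c′,c)| ≤ C₁ C₂ A C_c · ℓ(b)^{p−2} ℓ(c)^{−d} e^{−θ d(b,c)}`.  Content: the
triangle inequality for the finite sum, `ℓ(c′)^d ℓ(c′)^{−d} = 1`, `ℓ(b)^p = ℓ(b)^{p−2} ℓ(b)²`, monotonicity of `exp`.
[cite: Balaban1984PropagatorsII, Cor. 2.8 p.249 with (2.88) p.238] -/
theorem comp_bound (ℓ : S → ℝ) (dist : S → S → ℝ) (d : ℕ) (K₁ K₂ : S → S → ℝ)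
    (p C₁ C₂ δ δ' ε δ₀ A Cc θ : ℝ)
    (hℓ : ∀ y, 0 < ℓ y) (hdist : ∀ y y', 0 ≤ dist y y') (hC₁ : 0 ≤ C₁) (hC₂ : 0 ≤ C₂) (hA : 0 ≤ A)
    (hδ : δ₀ + ε ≤ δ) (hδ' : δ₀ ≤ δ')
    (hK₁ : KerBound136 ℓ dist d K₁ p C₁ δ) (hK₂ : KerBound149 ℓ dist d K₂ C₂ δ')
    (hAbs : ScaleAbsorb ℓ dist ε A) (hConv : Conv263 dist δ₀ Cc θ) (b c : S) :
    |compKer ℓ d K₁ K₂ b c| ≤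
      C₁ * C₂ * A * Cc * ℓ b ^ (p - 2) * ℓ c ^ (-(d : ℝ)) * Real.exp (-(θ * dist b c)) := by
  unfold compKer
  -- the constant in front of the convolution sum
  set M : ℝ := C₁ * C₂ * ℓ b ^ (p - 2) * ℓ c ^ (-(d : ℝ)) with hM
  have hMnn : 0 ≤ M := by
    rw [hM]
    have h1 : 0 ≤ ℓ b ^ (p - 2) := Real.rpow_nonneg (le_of_lt (hℓ b)) _
    have h2 : 0 ≤ ℓ c ^ (-(d : ℝ)) := Real.rpow_nonneg (le_of_lt (hℓ c)) _
    positivity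
  -- termwise bound
  have key : ∀ c', ℓ c' ^ (d : ℝ) * |K₁ b c'| * |K₂ c' c| ≤
      M * (A * (Real.exp (-(δ₀ * dist b c')) * Real.exp (-(δ₀ * dist c' c)))) := by
    intro c'
    have h1 := hK₁ b c'
    have h2 := hK₂ c' c
    have e1 := exp_split_le δ ε δ₀ (dist b c') hδ (hdist b c')
    have e2 := exp_weaken_le δ' δ₀ (dist c' c) hδ' (hdist c' c)
    have hw : 0 ≤ ℓ c' ^ (d : ℝ) := Real.rpow_nonneg (le_of_lt (hℓ c')) _
    have hbp : 0 ≤ ℓ b ^ p := Real.rpow_nonneg (le_of_lt (hℓ b)) _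
    have hcd : 0 ≤ ℓ c' ^ (-(d : ℝ)) := Real.rpow_nonneg (le_of_lt (hℓ c')) _
    have hc2 : 0 ≤ ℓ c' ^ (-(2 : ℝ)) := Real.rpow_nonneg (le_of_lt (hℓ c')) _
    have hcc : 0 ≤ ℓ c ^ (-(d : ℝ)) := Real.rpow_nonneg (le_of_lt (hℓ c)) _
    -- upgrade the two kernel bounds to the split exponentials
    have h1' : |K₁ b c'| ≤ C₁ * ℓ b ^ p * ℓ c' ^ (-(d : ℝ)) *
        (Real.exp (-(ε * dist b c')) * Real.exp (-(δ₀ * dist b c'))) :=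
      h1.trans (mul_le_mul_of_nonneg_left e1 (by positivity))
    have h2' : |K₂ c' c| ≤ C₂ * ℓ c' ^ (-(2 : ℝ)) * ℓ c ^ (-(d : ℝ)) * Real.exp (-(δ₀ * dist c' c)) :=
      h2.trans (mul_le_mul_of_nonneg_left e2 (by positivity))
    -- the algebraic identities ℓ(c′)^d ℓ(c′)^{−d} = 1 and ℓ(b)^p = ℓ(b)^{p−2} ℓ(b)²
    have r1 : ℓ c' ^ (d : ℝ) * ℓ c' ^ (-(d : ℝ)) = 1 := by
      rw [← Real.rpow_add (hℓ c')]; simp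
    have r2 : ℓ b ^ p = ℓ b ^ (p - 2) * ℓ b ^ (2 : ℝ) := by
      rw [← Real.rpow_add (hℓ b)]; ring_nf
    calc ℓ c' ^ (d : ℝ) * |K₁ b c'| * |K₂ c' c|
        ≤ ℓ c' ^ (d : ℝ) * (C₁ * ℓ b ^ p * ℓ c' ^ (-(d : ℝ)) *
            (Real.exp (-(ε * dist b c')) * Real.exp (-(δ₀ * dist b c')))) *
          (C₂ * ℓ c' ^ (-(2 : ℝ)) * ℓ c ^ (-(d : ℝ)) * Real.exp (-(δ₀ * dist c' c))) := by
          apply mul_le_mul (mul_le_mul_of_nonneg_left h1' hw) h2' (abs_nonneg _)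
          positivity
      _ = (ℓ c' ^ (d : ℝ) * ℓ c' ^ (-(d : ℝ))) *
          (M * ((ℓ b ^ (2 : ℝ) * ℓ c' ^ (-(2 : ℝ)) * Real.exp (-(ε * dist b c'))) *
            (Real.exp (-(δ₀ * dist b c')) * Real.exp (-(δ₀ * dist c' c))))) := by
          rw [hM, r2]; ring
      _ = M * ((ℓ b ^ (2 : ℝ) * ℓ c' ^ (-(2 : ℝ)) * Real.exp (-(ε * dist b c'))) *
            (Real.exp (-(δ₀ * dist b c')) * Real.exp (-(δ₀ * dist c' c)))) := by
          rw [r1, one_mul]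
      _ ≤ M * (A * (Real.exp (-(δ₀ * dist b c')) * Real.exp (-(δ₀ * dist c' c)))) := by
          apply mul_le_mul_of_nonneg_left _ hMnn
          exact mul_le_mul_of_nonneg_right (hAbs b c') (by positivity)
  -- sum the termwise bounds and convolve
  calc |∑ c', ℓ c' ^ (d : ℝ) * K₁ b c' * K₂ c' c|
      ≤ ∑ c', |ℓ c' ^ (d : ℝ) * K₁ b c' * K₂ c' c| := Finset.abs_sum_le_sum_abs _ _
    _ = ∑ c', ℓ c' ^ (d : ℝ) * |K₁ b c'| * |K₂ c' c| := by
        refine Finset.sum_congr rfl fun c' _ => ?_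
        rw [abs_mul, abs_mul, abs_of_nonneg (Real.rpow_nonneg (le_of_lt (hℓ c')) _)]
    _ ≤ ∑ c', M * (A * (Real.exp (-(δ₀ * dist b c')) * Real.exp (-(δ₀ * dist c' c)))) :=
        Finset.sum_le_sum fun c' _ => key c'
    _ = M * A * ∑ c', Real.exp (-(δ₀ * dist b c')) * Real.exp (-(δ₀ * dist c' c)) := by
        rw [Finset.mul_sum]
        refine Finset.sum_congr rfl fun c' _ => ?_
        ring
    _ ≤ M * A * (Cc * Real.exp (-(θ * dist b c))) :=
        mul_le_mul_of_nonneg_left (hConv b c) (by positivity)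
    _ = C₁ * C₂ * A * Cc * ℓ b ^ (p - 2) * ℓ c ^ (-(d : ℝ)) * Real.exp (-(θ * dist b c)) := by
        rw [hM]; ring

/-! ## The three scaling entries of Corollary 2.8 -/

/-- The conclusion shape of Cor. 2.8, entry by entry: `|H(b,c)| ≤ C ℓ(b)^{−q} ℓ(c)^{−d} e^{−δ₅ d(b,c)}` with
`q = 0, 1, 1+α` for |H|, |∇H|, ‖ζ∇H‖_α (p. 249: *"≤ O(1)[1, (L^jη)^{−1}, (L^jη)^{−1−α}(‖ζ‖^ξ_α + |ζ|)](L^{j′}η)^{−d}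
e^{−δ₅d(y,c₋)}"*; the sup over b ∈ Δ(y) collapsed to the site level exactly as in `B6.Cor28Printed`). [cite: Balaban1984PropagatorsII, Cor. 2.8 (2.150)–(1.151)[sic] p.249] -/
def Cor28Entry (ℓ : S → ℝ) (dist : S → S → ℝ) (d : ℕ) (H : S → S → ℝ) (q C δ₅ : ℝ) : Prop :=
  ∀ b c, |H b c| ≤ C * ℓ b ^ (-q) * ℓ c ^ (-(d : ℝ)) * Real.exp (-(δ₅ * dist b c))

/-- **Cor. 2.8 ⇐ Prop. 2.6 ∘ Prop. 2.7 via Lemma 2.1** for one scaling entry: with the (2.136)/(2.137)-kernel power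
`p = 2 − q` (q = 0: |H|; q = 1: |∇H|; q = 1 + α: the Hölder entry), the (2.150)-kernel `compKer ℓ d K₁ K₂` of
H = GQ*(QGQ*)^{−1} satisfies the Cor. 2.8 entry with `δ₅ = θ` and `O(1) = C₁C₂AC_c`.  Immediate from `comp_bound`.
[cite: Balaban1984PropagatorsII, Cor. 2.8 p.249] -/
theorem cor28_scaling_entries (ℓ : S → ℝ) (dist : S → S → ℝ) (d : ℕ) (K₁ K₂ : S → S → ℝ)
    (q C₁ C₂ δ δ' ε δ₀ A Cc θ : ℝ)
    (hℓ : ∀ y, 0 < ℓ y) (hdist : ∀ y y', 0 ≤ dist y y') (hC₁ : 0 ≤ C₁) (hC₂ : 0 ≤ C₂) (hA : 0 ≤ A)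
    (hδ : δ₀ + ε ≤ δ) (hδ' : δ₀ ≤ δ')
    (hK₁ : KerBound136 ℓ dist d K₁ (2 - q) C₁ δ) (hK₂ : KerBound149 ℓ dist d K₂ C₂ δ')
    (hAbs : ScaleAbsorb ℓ dist ε A) (hConv : Conv263 dist δ₀ Cc θ) :
    Cor28Entry ℓ dist d (compKer ℓ d K₁ K₂) q (C₁ * C₂ * A * Cc) θ := by
  intro b c
  have h := comp_bound ℓ dist d K₁ K₂ (2 - q) C₁ C₂ δ δ' ε δ₀ A Cc θ hℓ hdist hC₁ hC₂ hA hδ hδ' hK₁ hK₂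
    hAbs hConv b c
  have hq : (2 - q) - 2 = -q := by ring
  rw [hq] at h
  exact h

/-! ## The absorption constant from (2.60) -/

/-- **The absorption follows from (2.60)** (Lemma 2.1, p. 234) — the quantitative content of "M sufficiently large"
at this step: for `1 ≤ L`, `L² ≤ e^{εRM}` (ε = αδ₀) and an INTEGER scale difference `t = j(b) − j(c′)` (so `t ≤ 0`
or `1 ≤ t`), `L^{2t} e^{−εRM·max(|t|−1,0)} ≤ L²`.  Case `t ≤ 0`: both factors ≤ 1.  Case `t ≥ 1`: `L^{2t} = L²
(L²)^{t−1} ≤ L² (e^{εRM})^{t−1} = L² e^{εRM(t−1)}`. [folklore] -/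
theorem absorb_of_260 (L ε R M t : ℝ) (hL : 1 ≤ L) (hlarge : L ^ (2 : ℝ) ≤ Real.exp (ε * R * M))
    (ht : t ≤ 0 ∨ 1 ≤ t) :
    L ^ (2 * t) * Real.exp (-(ε * R * M * max (|t| - 1) 0)) ≤ L ^ (2 : ℝ) := by
  have hL0 : 0 < L := lt_of_lt_of_le one_pos hL
  have hL2 : 1 ≤ L ^ (2 : ℝ) := Real.one_le_rpow hL (by norm_num)
  rcases ht with ht | ht
  · -- t ≤ 0: L^{2t} ≤ 1 and the exponential factor ≤ 1
    have h1 : L ^ (2 * t) ≤ 1 := Real.rpow_le_one_of_one_le_of_nonpos hL (by linarith)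
    -- `L² ≤ e^{εRM}` with `L ≥ 1` forces `εRM ≥ 0`, so the exponential factor is ≤ 1 as well
    have hε : 0 ≤ ε * R * M := by
      have h1e : Real.exp 0 ≤ Real.exp (ε * R * M) := by
        rw [Real.exp_zero]; exact le_trans hL2 hlarge
      exact Real.exp_le_exp.mp h1e
    have h3 : Real.exp (-(ε * R * M * max (|t| - 1) 0)) ≤ 1 := by
      rw [Real.exp_le_one_iff]
      have : 0 ≤ max (|t| - 1) 0 := le_max_right _ _
      nlinarith
    calc L ^ (2 * t) * Real.exp (-(ε * R * M * max (|t| - 1) 0)) ≤ 1 * 1 :=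
          mul_le_mul h1 h3 (Real.exp_nonneg _) zero_le_one
      _ ≤ L ^ (2 : ℝ) := by rw [one_mul]; exact hL2
  · -- t ≥ 1: max(|t| − 1, 0) = t − 1 and L^{2t} = L² (L²)^{t−1} ≤ L² e^{εRM(t−1)}
    have habs : |t| = t := abs_of_pos (lt_of_lt_of_le one_pos ht)
    have hmax : max (|t| - 1) 0 = t - 1 := by rw [habs]; exact max_eq_left (by linarith)
    rw [hmax]
    have hsplit : L ^ (2 * t) = L ^ (2 : ℝ) * (L ^ (2 : ℝ)) ^ (t - 1) := by
      rw [← Real.rpow_mul (le_of_lt hL0), ← Real.rpow_add hL0]; ring_nf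
    have hpow : (L ^ (2 : ℝ)) ^ (t - 1) ≤ (Real.exp (ε * R * M)) ^ (t - 1) :=
      Real.rpow_le_rpow (by positivity) hlarge (by linarith)
    have hexp : (Real.exp (ε * R * M)) ^ (t - 1) = Real.exp (ε * R * M * (t - 1)) := by
      rw [← Real.exp_mul]
    rw [hsplit, mul_assoc]
    apply mul_le_of_le_one_right (by positivity)
    calc (L ^ (2 : ℝ)) ^ (t - 1) * Real.exp (-(ε * R * M * (t - 1)))
        ≤ Real.exp (ε * R * M * (t - 1)) * Real.exp (-(ε * R * M * (t - 1))) :=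
          mul_le_mul_of_nonneg_right (hpow.trans (le_of_eq hexp)) (Real.exp_nonneg _)
      _ = 1 := by rw [← Real.exp_add]; simp

omit [Fintype S] in
/-- The site form of the absorption: with `ℓ(y) = L^{j(y)} η` (η > 0, L ≥ 1, integer scales j), (2.60) in the
shape of the first clause of `B6.Lemma21Printed` with rate `ε` (= αδ₀), and `L² ≤ e^{εRM}`, the hypothesis
`ScaleAbsorb ℓ dist ε (L²)` of `comp_bound` HOLDS.  [cite: Balaban1984PropagatorsII, Lemma 2.1 (2.60) p.234] -/
theorem scaleAbsorb_of_260 (j : S → ℕ) (dist : S → S → ℝ) (L η ε R M : ℝ) (hL : 1 ≤ L) (hη : 0 < η)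
    (hlarge : L ^ (2 : ℝ) ≤ Real.exp (ε * R * M))
    (h260 : ∀ y y', Real.exp (-(ε * dist y y')) ≤
      Real.exp (-(ε * R * M * max (|((j y : ℝ)) - (j y' : ℝ)| - 1) 0))) :
    ScaleAbsorb (fun y => L ^ (j y : ℝ) * η) dist ε (L ^ (2 : ℝ)) := by
  intro b c'
  have hL0 : 0 < L := lt_of_lt_of_le one_pos hL
  have hLb : 0 < L ^ (j b : ℝ) := Real.rpow_pos_of_pos hL0 _
  have hLc : 0 < L ^ (j c' : ℝ) := Real.rpow_pos_of_pos hL0 _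
  -- (L^{j(b)}η)² (L^{j(c′)}η)^{−2} = L^{2t}, t = j(b) − j(c′)
  set t : ℝ := (j b : ℝ) - (j c' : ℝ) with ht
  have hpow : (L ^ (j b : ℝ) * η) ^ (2 : ℝ) * (L ^ (j c' : ℝ) * η) ^ (-(2 : ℝ)) = L ^ (2 * t) := by
    rw [Real.mul_rpow (le_of_lt hLb) (le_of_lt hη), Real.mul_rpow (le_of_lt hLc) (le_of_lt hη),
      ← Real.rpow_mul (le_of_lt hL0), ← Real.rpow_mul (le_of_lt hL0),
      Real.rpow_neg (le_of_lt hη), ht]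
    have hη2 : η ^ (2 : ℝ) ≠ 0 := ne_of_gt (Real.rpow_pos_of_pos hη _)
    have : L ^ ((j b : ℝ) * 2) * L ^ ((j c' : ℝ) * -2) = L ^ (2 * ((j b : ℝ) - (j c' : ℝ))) := by
      rw [← Real.rpow_add hL0]; ring_nf
    calc L ^ ((j b : ℝ) * 2) * η ^ (2 : ℝ) * (L ^ ((j c' : ℝ) * -2) * (η ^ (2 : ℝ))⁻¹)
        = (L ^ ((j b : ℝ) * 2) * L ^ ((j c' : ℝ) * -2)) * (η ^ (2 : ℝ) * (η ^ (2 : ℝ))⁻¹) := by ring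
      _ = L ^ (2 * ((j b : ℝ) - (j c' : ℝ))) := by rw [this, mul_inv_cancel₀ hη2, mul_one]
  have hint : t ≤ 0 ∨ 1 ≤ t := by
    rcases Nat.lt_or_ge (j c') (j b) with h | h
    · right
      have h' : (j c' : ℝ) + 1 ≤ (j b : ℝ) := by exact_mod_cast h
      rw [ht]; linarith
    · left
      have h' : (j b : ℝ) ≤ (j c' : ℝ) := by exact_mod_cast h
      rw [ht]; linarith
  calc (L ^ (j b : ℝ) * η) ^ (2 : ℝ) * (L ^ (j c' : ℝ) * η) ^ (-(2 : ℝ)) * Real.exp (-(ε * dist b c'))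
      = L ^ (2 * t) * Real.exp (-(ε * dist b c')) := by rw [hpow]
    _ ≤ L ^ (2 * t) * Real.exp (-(ε * R * M * max (|t| - 1) 0)) :=
        mul_le_mul_of_nonneg_left (by simpa [ht] using h260 b c') (le_of_lt (Real.rpow_pos_of_pos hL0 _))
    _ ≤ L ^ (2 : ℝ) := absorb_of_260 L ε R M t hL hlarge hint

/-! ## Over the carrier of `…B6`: the shape of `B6.Cor28Printed`, and the absorption from `B6.Lemma21Printed` -/

/-- `B6.Geometry.len` (L^jη for y ∈ Λ_j, a natural-number power in `…B6`) as a real power. [folklore] -/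
theorem len_eq_rpow (g : B6.Geometry) : g.len = fun y => g.L ^ (g.scale y : ℝ) * g.eta := by
  funext y
  simp [B6.Geometry.len, Real.rpow_natCast]

/-- The absorption hypothesis of `comp_bound` DISCHARGED from the sibling module's typed Lemma 2.1: the first clause
(2.60) of `B6.Lemma21Printed` at rate `αδ₀` (under its printed conditions 0 < α < 1 and (2.59)), `1 ≤ L`, `0 < η`
and the largeness `L² ≤ e^{αδ₀RM}` give `ScaleAbsorb len dist (αδ₀) L²` for that geometry. [cite: Balaban1984PropagatorsII, Lemma 2.1 (2.60) p.234] -/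
theorem scaleAbsorb_of_lemma21 {I : Type} (d : ℕ) (δ₀ : ℝ) (geo : I → B6.Geometry)
    (h21 : B6.Lemma21Printed d δ₀ geo) (i : I) (hH : (geo i).Hyp21_22) (α : ℝ) (hα0 : 0 < α) (hα1 : α < 1)
    (h259 : B6.Cond259 d δ₀ α (geo i).R (geo i).M) (hL : 1 ≤ (geo i).L) (hη : 0 < (geo i).eta)
    (hlarge : (geo i).L ^ (2 : ℝ) ≤ Real.exp (α * δ₀ * (geo i).R * (geo i).M)) :
    ScaleAbsorb (geo i).len (geo i).dist (α * δ₀) ((geo i).L ^ (2 : ℝ)) := by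
  have h260 := (h21 i hH α hα0 hα1 h259).1
  rw [len_eq_rpow]
  exact scaleAbsorb_of_260 (geo i).scale (geo i).dist (geo i).L (geo i).eta (α * δ₀) (geo i).R (geo i).M hL hη
    hlarge h260

/-- **The first conjunct of `B6.Cor28Printed`, in shape, for one geometry**: with `(H i).e n y c := |compKer len d
(K₁ n) K₂ y c|` (n = 0: the kernel of H = GQ*(QGQ*)^{−1}; n = 1: of ∇H), the kernel bounds (2.136) (powers
(L^jη)², L^jη, i.e. `p = 2 − n`), (2.149), the absorption and the convolution give exactly
`(H i).e n y c ≤ C · len y ^ (−n) · len c ^ (−d) · e^{−δ₅ d(y,c)}` with `δ₅ = θ`, `C = C₁C₂AC_c` — the displayed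
first conjunct of `B6.Cor28Printed` (whose outer `∃ M₁ δ₅ C Cα, ∀ i, Hyp21_22 → M₁ ≤ M → …` quantifies these
constants uniformly over the family; here one geometry, constants explicit). [cite: Balaban1984PropagatorsII, Cor. 2.8 p.249] -/
theorem cor28_first_conjunct_shape (g : B6.Geometry) (d : ℕ) (K₁ : Fin 2 → g.Site → g.Site → ℝ)
    (K₂ : g.Site → g.Site → ℝ) (C₁ C₂ δ δ' ε δ₀ A Cc θ : ℝ)
    (hℓ : ∀ y, 0 < g.len y) (hdist : ∀ y y', 0 ≤ g.dist y y') (hC₁ : 0 ≤ C₁) (hC₂ : 0 ≤ C₂) (hA : 0 ≤ A)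
    (hδ : δ₀ + ε ≤ δ) (hδ' : δ₀ ≤ δ')
    (hK₁ : ∀ n : Fin 2, KerBound136 g.len g.dist d (K₁ n) (2 - (n : ℝ)) C₁ δ)
    (hK₂ : KerBound149 g.len g.dist d K₂ C₂ δ') (hAbs : ScaleAbsorb g.len g.dist ε A)
    (hConv : Conv263 g.dist δ₀ Cc θ) :
    ∀ (n : Fin 2) (y c : g.Site), |compKer g.len d (K₁ n) K₂ y c| ≤
      C₁ * C₂ * A * Cc * g.len y ^ (-(n : ℝ)) * g.len c ^ (-(d : ℝ)) * Real.exp (-(θ * g.dist y c)) :=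
  fun n => cor28_scaling_entries g.len g.dist d (K₁ n) K₂ (n : ℝ) C₁ C₂ δ δ' ε δ₀ A Cc θ hℓ hdist hC₁ hC₂ hA hδ
    hδ' (hK₁ n) hK₂ hAbs hConv

/-! ## Everything but the two kernel bounds discharged from the tree's typed Lemma 2.1 -/

/-- The convolution hypothesis of `comp_bound` IS the one-intermediate-point instance (m = 1) of the tree's typed
(2.63), `B6RandomWalk.Ineq263` (unit pv08, kernel-derived there from (2.61) + (2.54)): `C_c = c₁(α)²`,
`θ = (1−α)δ₀`. [cite: Balaban1984PropagatorsII, Lemma 2.1 (2.63) p.234] -/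
theorem conv263_of_ineq263 (d : ℕ) (g : B6.Geometry) (δ₀ α : ℝ) (h : B6RandomWalk.Ineq263 d g δ₀ α) :
    Conv263 g.dist δ₀ (B6.c1 d δ₀ α ^ 2) ((1 - α) * δ₀) := by
  intro b c
  have h1 := h 1 b c
  simpa [B6RandomWalk.chain] using h1

/-- `len > 0` from `1 ≤ L`, `0 < η`. [folklore] -/
theorem len_pos (g : B6.Geometry) (hL : 1 ≤ g.L) (hη : 0 < g.eta) (y : g.Site) : 0 < g.len y := by
  unfold B6.Geometry.len
  have hL0 : 0 < g.L := lt_of_lt_of_le one_pos hL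
  positivity

/-- **Cor. 2.8 (first conjunct, in shape) ⇐ the kernel form of (2.136) + (2.149) + the TYPED Lemma 2.1 of the tree.**
For a geometry of a family satisfying `B6.Lemma21Printed d δ₀ geo` (δ₀ ≥ 0) and the triangle inequality (2.54)
(`B6RandomWalk.Triangle254`), under (2.1)–(2.2) (`Hyp21_22`), 0 < α < 1, (2.59) (`B6.Cond259`), `1 ≤ L`, `0 < η`,
`d(·,·) ≥ 0` and the largeness `L² ≤ e^{αδ₀RM}`: if the kernels `K₁ n` (n = 0, 1) obey the (2.136)-type bounds with
powers (L^jη)^{2−n} and rate δ₃ ≥ (1+α)δ₀, and `K₂` obeys (2.149) with rate δ₄′ ≥ δ₀ (δ₄′ = ½δ₄), then the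
(2.150)-kernels `compKer len d (K₁ n) K₂` of H, ∇H satisfy the displayed first conjunct of `B6.Cor28Printed` with
`δ₅ = (1−α)δ₀` and `O(1) = C₁C₂L²c₁(α)²`.  The absorption ((2.60), `scaleAbsorb_of_lemma21`) and the convolution
((2.63), `conv263_of_ineq263` ∘ `B6RandomWalk.ineq263_of_261`) are DISCHARGED; only the two kernel bounds and the
listed side conditions remain hypotheses. [cite: Balaban1984PropagatorsII, Cor. 2.8 p.249; Lemma 2.1 p.234] -/
theorem cor28_entries_of_lemma21 {I : Type} (d : ℕ) (δ₀ : ℝ) (hδ₀ : 0 ≤ δ₀) (geo : I → B6.Geometry)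
    (h21 : B6.Lemma21Printed d δ₀ geo) (i : I) (htri : B6RandomWalk.Triangle254 (geo i))
    (hH : (geo i).Hyp21_22) (α : ℝ) (hα0 : 0 < α) (hα1 : α < 1)
    (h259 : B6.Cond259 d δ₀ α (geo i).R (geo i).M) (hL : 1 ≤ (geo i).L) (hη : 0 < (geo i).eta)
    (hlarge : (geo i).L ^ (2 : ℝ) ≤ Real.exp (α * δ₀ * (geo i).R * (geo i).M))
    (hdist : ∀ y y', 0 ≤ (geo i).dist y y')
    (K₁ : Fin 2 → (geo i).Site → (geo i).Site → ℝ) (K₂ : (geo i).Site → (geo i).Site → ℝ)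
    (C₁ C₂ δ₃ δ₄' : ℝ) (hC₁ : 0 ≤ C₁) (hC₂ : 0 ≤ C₂) (hδ₃ : δ₀ + α * δ₀ ≤ δ₃) (hδ₄ : δ₀ ≤ δ₄')
    (hK₁ : ∀ n : Fin 2, KerBound136 (geo i).len (geo i).dist d (K₁ n) (2 - (n : ℝ)) C₁ δ₃)
    (hK₂ : KerBound149 (geo i).len (geo i).dist d K₂ C₂ δ₄') :
    ∀ (n : Fin 2) (y c : (geo i).Site), |compKer (geo i).len d (K₁ n) K₂ y c| ≤
      C₁ * C₂ * (geo i).L ^ (2 : ℝ) * B6.c1 d δ₀ α ^ 2 * (geo i).len y ^ (-(n : ℝ)) *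
        (geo i).len c ^ (-(d : ℝ)) * Real.exp (-((1 - α) * δ₀ * (geo i).dist y c)) := by
  have h261 := (h21 i hH α hα0 hα1 h259).2
  have h263 := B6RandomWalk.ineq263_of_261 d (geo i) δ₀ α htri hδ₀ hα1.le h261
  have hconv := conv263_of_ineq263 d (geo i) δ₀ α h263
  have habs := scaleAbsorb_of_lemma21 d δ₀ geo h21 i hH α hα0 hα1 h259 hL hη hlarge
  have hL2 : 0 ≤ (geo i).L ^ (2 : ℝ) := Real.rpow_nonneg (le_trans zero_le_one hL) _
  exact cor28_first_conjunct_shape (geo i) d K₁ K₂ C₁ C₂ δ₃ δ₄' (α * δ₀) δ₀ ((geo i).L ^ (2 : ℝ))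
    (B6.c1 d δ₀ α ^ 2) ((1 - α) * δ₀) (len_pos (geo i) hL hη) hdist hC₁ hC₂ hL2 hδ₃ hδ₄ hK₁ hK₂ habs hconv

/-! ## REVISION v2 (node T03.3): the model computation (2.88) p. 238 KERNEL-CHECKED

Render p. 238 [PDF 16], verbatim: *"Finally let us consider the kernel of the operator ∂P∂* appearing in ∂R∂*,
R = I − P given by (2.18). We have from Lemma 2.1, Proposition 2.2 and (2.87), |(∂P∂*)_{μν}(x, x′)| =
|(∂_μG′Q′*(Q′G′²Q′*)^{−1}Q′G′∂_ν*)(x, x′)| ≤ O(1) Σ_{y₁,y₂∈𝔅} L^jη e^{−½δ₀d(y,y₁)}(L^{j₁}η)^{−4}e^{−½δ₁d(y₁,y₂)}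
(L^{j₂}η)^{−d} · e^{−½δ₀d(y₂,y′)}L^{j′}η ≤ O(1)(L^jη)^{−2}(L^{j′}η)^{−d}e^{−δ₂d(y,y′)}, (2.88) where x ∈ Bʲ(y), x′ ∈
B^{j′}(y′), y ∈ Λ_j, y′ ∈ Λ_{j′}, and δ₂ is determined by δ₀, δ₁. The choice of factors is again arbitrary and may
be changed into any other admissible choice."*  The SECOND inequality of (2.88) is pure multiscale power counting:
three kernels, two intermediate points, powers ℓ(y)¹ ℓ(y₁)^{−4} ℓ(y₂)^{−d} ℓ(y′)¹ ↦ ℓ(y)^{−2} ℓ(y′)^{−d}.  It is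
kernel-checked below (`ineq288_kernel`) from: SCALE TRANSFER `ℓ(a)^q ≤ A e^{εd(a,b)} ℓ(b)^q` in both directions
(`TransferR`, `TransferL`; DERIVED from (2.60) under `L^{|q|} ≤ e^{εRM}` in `transfer_of_260`), the triangle
inequality (2.54), and (2.63) with two intermediate points (`Conv3`; = m = 2 of `B6RandomWalk.Ineq263`,
`conv3_of_ineq263`); `ineq288_of_lemma21` assembles it over `B6.Geometry` from the tree's typed Lemma 2.1, with
δ₂ = (1−α)δ_* for every δ_* ≥ 0 with (1+2α)δ_* ≤ ½δ₀ and (1+α)δ_* ≤ ½δ₁ — "δ₂ is determined by δ₀, δ₁" made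
explicit — and O(1) = C₁C₂C₃·L⁴·L^d·L·c₁(α)³.  The FIRST inequality of (2.88) (the kernel forms of Prop. 2.2's
entries ∇G′, G′∇* with λ = Q′*δ_{y₁}, and (2.87)) stays the three kernel-bound HYPOTHESES; (2.86) ⇒ (2.87) (the
Neumann bookkeeping of Prop. 2.3) is node T03.2's chain machinery (unit pv08), not reproduced here.
-/

/-- SCALE TRANSFER to the right: `ℓ(a)^q ≤ A e^{ε d(a,b)} ℓ(b)^q` (a power of the scale of the first point of an
ordered pair is moved to the second at the price of a growth factor).  Hypothesis shape; derived from (2.60) in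
`transfer_of_260`. [cite: Balaban1984PropagatorsII, (2.60) p.234 with (2.88) p.238] -/
def TransferR (ℓ : S → ℝ) (dist : S → S → ℝ) (ε q A : ℝ) : Prop :=
  ∀ a b, ℓ a ^ q ≤ A * Real.exp (ε * dist a b) * ℓ b ^ q

/-- SCALE TRANSFER to the left: `ℓ(b)^q ≤ A e^{ε d(a,b)} ℓ(a)^q`. [cite: Balaban1984PropagatorsII, (2.60) p.234 with (2.88) p.238] -/
def TransferL (ℓ : S → ℝ) (dist : S → S → ℝ) (ε q A : ℝ) : Prop :=
  ∀ a b, ℓ b ^ q ≤ A * Real.exp (ε * dist a b) * ℓ a ^ q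

/-- (2.63) with two intermediate points (n = 3), in the nesting used below: `Σ_{y₁} e^{−δd(y,y₁)} Σ_{y₂}
e^{−δd(y₁,y₂)} e^{−δd(y₂,y′)} ≤ C_c e^{−θ d(y,y′)}` (`C_c = c₁(α)³`, `θ = (1−α)δ`).  Hypothesis shape; = m = 2 of
`B6RandomWalk.Ineq263` (`conv3_of_ineq263`). [cite: Balaban1984PropagatorsII, Lemma 2.1 (2.63) p.234] -/
def Conv3 (dist : S → S → ℝ) (δ Cc θ : ℝ) : Prop :=
  ∀ y y', ∑ y₁, Real.exp (-(δ * dist y y₁)) *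
      ∑ y₂, Real.exp (-(δ * dist y₁ y₂)) * Real.exp (-(δ * dist y₂ y')) ≤ Cc * Real.exp (-(θ * dist y y'))

/-- The plain (unweighted, as printed in (2.88)) three-fold kernel composition
`Σ_{y₁,y₂∈𝔅} K₁(y,y₁) K₂(y₁,y₂) K₃(y₂,y′)`. [cite: Balaban1984PropagatorsII, (2.88) p.238] -/
noncomputable def comp3 (K₁ K₂ K₃ : S → S → ℝ) (y y' : S) : ℝ :=
  ∑ y₁, ∑ y₂, K₁ y y₁ * K₂ y₁ y₂ * K₃ y₂ y'

/-- Core of the scale transfer: for `1 ≤ L`, `L^{|q|} ≤ e^{E}` and an integer scale difference `t`,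
`L^{qt} ≤ L^{|q|} e^{E·max(|t|−1,0)}`.  Case `qt ≤ 0`: the left side is ≤ 1.  Case `qt > 0`: `|t| ≥ 1` and
`L^{qt} = L^{|q|}(L^{|q|})^{|t|−1} ≤ L^{|q|}(e^{E})^{|t|−1}`. [folklore] -/
theorem transfer_core (L E q t : ℝ) (hL : 1 ≤ L) (hlarge : L ^ |q| ≤ Real.exp E)
    (ht : t ≤ -1 ∨ t = 0 ∨ 1 ≤ t) :
    L ^ (q * t) ≤ L ^ |q| * Real.exp (E * max (|t| - 1) 0) := by
  have hL0 : 0 < L := lt_of_lt_of_le one_pos hL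
  have hLq : 1 ≤ L ^ |q| := Real.one_le_rpow hL (abs_nonneg q)
  have hE : 0 ≤ E := by
    have h1e : Real.exp 0 ≤ Real.exp E := by rw [Real.exp_zero]; exact le_trans hLq hlarge
    exact Real.exp_le_exp.mp h1e
  by_cases hqt : q * t ≤ 0
  · have h1 : L ^ (q * t) ≤ 1 := Real.rpow_le_one_of_one_le_of_nonpos hL hqt
    have h2 : 1 ≤ Real.exp (E * max (|t| - 1) 0) := by
      rw [Real.one_le_exp_iff]; exact mul_nonneg hE (le_max_right _ _)
    calc L ^ (q * t) ≤ 1 * 1 := by rw [one_mul]; exact h1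
      _ ≤ L ^ |q| * Real.exp (E * max (|t| - 1) 0) := mul_le_mul hLq h2 zero_le_one (by positivity)
  · have hqt : 0 < q * t := not_le.mp hqt
    have ht1 : 1 ≤ |t| := by
      rcases ht with h | h | h
      · rw [abs_of_neg (by linarith)]; linarith
      · exfalso; rw [h, mul_zero] at hqt; exact lt_irrefl _ hqt
      · rw [abs_of_pos (by linarith)]; exact h
    have hmax : max (|t| - 1) 0 = |t| - 1 := max_eq_left (by linarith)
    have hqt' : q * t = |q| * |t| := by rw [← abs_mul]; exact (abs_of_pos hqt).symm
    rw [hmax, hqt']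
    have hsplit : L ^ (|q| * |t|) = L ^ |q| * (L ^ |q|) ^ (|t| - 1) := by
      rw [← Real.rpow_mul (le_of_lt hL0), ← Real.rpow_add hL0]; ring_nf
    have hpow : (L ^ |q|) ^ (|t| - 1) ≤ (Real.exp E) ^ (|t| - 1) :=
      Real.rpow_le_rpow (by positivity) hlarge (by linarith)
    have hexp : (Real.exp E) ^ (|t| - 1) = Real.exp (E * (|t| - 1)) := by rw [← Real.exp_mul]
    rw [hsplit]
    exact mul_le_mul_of_nonneg_left (hpow.trans (le_of_eq hexp)) (by positivity)

omit [Fintype S] in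
/-- The ratio of scale powers at `ℓ(y) = L^{j(y)}η`: `ℓ(a)^r ℓ(b)^{−r} = L^{r(j(a)−j(b))}`. [folklore] -/
theorem len_ratio_rpow (j : S → ℕ) (L η r : ℝ) (hL : 0 < L) (hη : 0 < η) (a b : S) :
    (L ^ (j a : ℝ) * η) ^ r * (L ^ (j b : ℝ) * η) ^ (-r) = L ^ (r * ((j a : ℝ) - (j b : ℝ))) := by
  have hLa : 0 < L ^ (j a : ℝ) := Real.rpow_pos_of_pos hL _
  have hLb : 0 < L ^ (j b : ℝ) := Real.rpow_pos_of_pos hL _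
  have hηr : η ^ r ≠ 0 := ne_of_gt (Real.rpow_pos_of_pos hη _)
  have e1 : (L ^ (j a : ℝ) * η) ^ r = L ^ ((j a : ℝ) * r) * η ^ r := by
    rw [Real.mul_rpow (le_of_lt hLa) (le_of_lt hη), ← Real.rpow_mul (le_of_lt hL)]
  have e2 : (L ^ (j b : ℝ) * η) ^ (-r) = L ^ ((j b : ℝ) * -r) * (η ^ r)⁻¹ := by
    rw [Real.mul_rpow (le_of_lt hLb) (le_of_lt hη), ← Real.rpow_mul (le_of_lt hL), Real.rpow_neg (le_of_lt hη)]
  rw [e1, e2]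
  calc L ^ ((j a : ℝ) * r) * η ^ r * (L ^ ((j b : ℝ) * -r) * (η ^ r)⁻¹)
      = (L ^ ((j a : ℝ) * r) * L ^ ((j b : ℝ) * -r)) * (η ^ r * (η ^ r)⁻¹) := by ring
    _ = L ^ ((j a : ℝ) * r + (j b : ℝ) * -r) := by rw [← Real.rpow_add hL, mul_inv_cancel₀ hηr, mul_one]
    _ = L ^ (r * ((j a : ℝ) - (j b : ℝ))) := by congr 1; ring

omit [Fintype S] in
/-- **Scale transfer from (2.60)**, both directions: with `ℓ(y) = L^{j(y)}η` (`1 ≤ L`, `0 < η`, integer scales),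
(2.60) at rate `ε` (first clause of `B6.Lemma21Printed`, ε = αδ₀) and the largeness `L^{|q|} ≤ e^{εRM}`, every real
power `q` transfers across an ordered pair with constant `L^{|q|}`: `TransferR` and `TransferL`.  The integer scale
difference t = j(a) − j(b) is ≤ −1, = 0 or ≥ 1; (2.60) is read as `e^{εRM·max(|t|−1,0)} ≤ e^{εd(a,b)}`.
[cite: Balaban1984PropagatorsII, Lemma 2.1 (2.60) p.234] -/
theorem transfer_of_260 (j : S → ℕ) (dist : S → S → ℝ) (L η ε R M q : ℝ) (hL : 1 ≤ L) (hη : 0 < η)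
    (hlarge : L ^ |q| ≤ Real.exp (ε * R * M))
    (h260 : ∀ y y', Real.exp (-(ε * dist y y')) ≤
      Real.exp (-(ε * R * M * max (|((j y : ℝ)) - (j y' : ℝ)| - 1) 0))) :
    TransferR (fun y => L ^ (j y : ℝ) * η) dist ε q (L ^ |q|) ∧
      TransferL (fun y => L ^ (j y : ℝ) * η) dist ε q (L ^ |q|) := by
  have hL0 : 0 < L := lt_of_lt_of_le one_pos hL
  have hℓ : ∀ y, 0 < L ^ (j y : ℝ) * η := fun y => mul_pos (Real.rpow_pos_of_pos hL0 _) hη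
  -- the ratio bound for the ordered pair (a, b) and the powers r = q and r = −q
  have ratio : ∀ (r : ℝ), |r| = |q| → ∀ a b : S,
      (L ^ (j a : ℝ) * η) ^ r * (L ^ (j b : ℝ) * η) ^ (-r) ≤ L ^ |q| * Real.exp (ε * dist a b) := by
    intro r hr a b
    set t : ℝ := (j a : ℝ) - (j b : ℝ) with ht
    have hint : t ≤ -1 ∨ t = 0 ∨ 1 ≤ t := by
      rcases lt_trichotomy (j a) (j b) with h | h | h
      · left
        have h' : (j a : ℝ) + 1 ≤ (j b : ℝ) := by exact_mod_cast h
        rw [ht]; linarith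
      · right; left; rw [ht, h]; ring
      · right; right
        have h' : (j b : ℝ) + 1 ≤ (j a : ℝ) := by exact_mod_cast h
        rw [ht]; linarith
    have h60 : Real.exp (ε * R * M * max (|t| - 1) 0) ≤ Real.exp (ε * dist a b) := by
      have h := h260 a b
      rw [Real.exp_le_exp] at h ⊢
      rw [← ht] at h
      linarith
    have hlr : L ^ |r| ≤ Real.exp (ε * R * M) := by rw [hr]; exact hlarge
    have hc := transfer_core L (ε * R * M) r t hL hlr hint
    rw [len_ratio_rpow j L η r hL0 hη a b, ← ht, hr] at *
    calc L ^ (r * t) ≤ L ^ |q| * Real.exp (ε * R * M * max (|t| - 1) 0) := hc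
      _ ≤ L ^ |q| * Real.exp (ε * dist a b) :=
          mul_le_mul_of_nonneg_left h60 (le_of_lt (Real.rpow_pos_of_pos hL0 _))
  refine ⟨fun a b => ?_, fun a b => ?_⟩
  · -- TransferR: ℓ(a)^q = (ℓ(a)^q ℓ(b)^{−q}) ℓ(b)^q
    have h := ratio q rfl a b
    have hb : 0 < (L ^ (j b : ℝ) * η) ^ q := Real.rpow_pos_of_pos (hℓ b) _
    have e : (L ^ (j a : ℝ) * η) ^ q =
        ((L ^ (j a : ℝ) * η) ^ q * (L ^ (j b : ℝ) * η) ^ (-q)) * (L ^ (j b : ℝ) * η) ^ q := by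
      rw [mul_assoc, Real.rpow_neg (le_of_lt (hℓ b)), inv_mul_cancel₀ (ne_of_gt hb), mul_one]
    rw [e]
    exact mul_le_mul_of_nonneg_right h (le_of_lt hb)
  · -- TransferL: ℓ(b)^q = (ℓ(a)^{−q} ℓ(b)^{q}) ℓ(a)^q, and ℓ(b)^q = ℓ(b)^{−(−q)}
    have h := ratio (-q) (abs_neg q) a b
    have ha : 0 < (L ^ (j a : ℝ) * η) ^ q := Real.rpow_pos_of_pos (hℓ a) _
    have e : (L ^ (j b : ℝ) * η) ^ q =
        ((L ^ (j a : ℝ) * η) ^ (-q) * (L ^ (j b : ℝ) * η) ^ (-(-q))) * (L ^ (j a : ℝ) * η) ^ q := by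
      rw [neg_neg, mul_comm ((L ^ (j a : ℝ) * η) ^ (-q)), mul_assoc, Real.rpow_neg (le_of_lt (hℓ a)),
        inv_mul_cancel₀ (ne_of_gt ha), mul_one]
    rw [e]
    exact mul_le_mul_of_nonneg_right h (le_of_lt ha)

/-- **The second inequality of (2.88), kernel-checked** (p. 238).  Over a finite multiscale set with `ℓ > 0`, a
distance `d ≥ 0` obeying the triangle inequality (2.54): if `|K₁(y,y₁)| ≤ C₁ ℓ(y) e^{−a d(y,y₁)}` (∂G′Q′*, Prop.
2.2 entry L^jη with λ = Q′*δ_{y₁}), `|K₂(y₁,y₂)| ≤ C₂ ℓ(y₁)^{−4} ℓ(y₂)^{−d} e^{−b d(y₁,y₂)}` ((2.87)) and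
`|K₃(y₂,y′)| ≤ C₃ ℓ(y′) e^{−c d(y₂,y′)}` (Q′G′∂*), the scale transfers `ℓ(y₁)^{−4} ↦ ℓ(y)^{−4}` (constant A₄),
`ℓ(y₂)^{−d} ↦ ℓ(y′)^{−d}` (A_d), `ℓ(y′) ↦ ℓ(y)` (A₁, across the chain via (2.54)) at rate `ε ≥ 0`, and the
convolution (2.63) at a rate `δ` with `δ + 2ε ≤ a`, `δ + ε ≤ b`, `δ + 2ε ≤ c`, then
`|Σ_{y₁,y₂} K₁K₂K₃| ≤ C₁C₂C₃A₄A_dA₁C_c · ℓ(y)^{−2} ℓ(y′)^{−d} e^{−θ d(y,y′)}` — the printed right-hand side with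
δ₂ = θ and O(1) explicit. [cite: Balaban1984PropagatorsII, (2.88) p.238] -/
theorem ineq288_kernel (ℓ : S → ℝ) (dist : S → S → ℝ) (d : ℕ) (K₁ K₂ K₃ : S → S → ℝ)
    (C₁ C₂ C₃ a b c ε δ A₄ Ad A₁ Cc θ : ℝ)
    (hℓ : ∀ y, 0 < ℓ y) (hdist : ∀ y y', 0 ≤ dist y y')
    (htri : ∀ x y z : S, dist x z ≤ dist x y + dist y z)
    (hC₁ : 0 ≤ C₁) (hC₂ : 0 ≤ C₂) (hC₃ : 0 ≤ C₃) (hA₄ : 0 ≤ A₄) (hAd : 0 ≤ Ad) (hA₁ : 0 ≤ A₁) (hε : 0 ≤ ε)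
    (ha : δ + 2 * ε ≤ a) (hb : δ + ε ≤ b) (hc : δ + 2 * ε ≤ c)
    (hK₁ : ∀ y y₁, |K₁ y y₁| ≤ C₁ * ℓ y ^ (1 : ℝ) * Real.exp (-(a * dist y y₁)))
    (hK₂ : ∀ y₁ y₂, |K₂ y₁ y₂| ≤
      C₂ * ℓ y₁ ^ (-(4 : ℝ)) * ℓ y₂ ^ (-(d : ℝ)) * Real.exp (-(b * dist y₁ y₂)))
    (hK₃ : ∀ y₂ y', |K₃ y₂ y'| ≤ C₃ * ℓ y' ^ (1 : ℝ) * Real.exp (-(c * dist y₂ y')))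
    (hT₄ : TransferL ℓ dist ε (-(4 : ℝ)) A₄) (hTd : TransferR ℓ dist ε (-(d : ℝ)) Ad)
    (hT₁ : TransferL ℓ dist ε (1 : ℝ) A₁) (hConv : Conv3 dist δ Cc θ) (y y' : S) :
    |comp3 K₁ K₂ K₃ y y'| ≤ C₁ * C₂ * C₃ * A₄ * Ad * A₁ * Cc *
      ℓ y ^ (-(2 : ℝ)) * ℓ y' ^ (-(d : ℝ)) * Real.exp (-(θ * dist y y')) := by
  unfold comp3
  have hy : 0 < ℓ y := hℓ y
  have hy' : 0 < ℓ y' := hℓ y'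
  set M : ℝ := C₁ * C₂ * C₃ * A₄ * Ad * A₁ * ℓ y ^ (-(2 : ℝ)) * ℓ y' ^ (-(d : ℝ)) with hM
  have hy2 : 0 ≤ ℓ y ^ (-(2 : ℝ)) := Real.rpow_nonneg (le_of_lt hy) _
  have hyd : 0 ≤ ℓ y' ^ (-(d : ℝ)) := Real.rpow_nonneg (le_of_lt hy') _
  have hMnn : 0 ≤ M := by rw [hM]; positivity
  -- the weight of the convolution
  set w : S → S → ℝ := fun u v => Real.exp (-(δ * dist u v)) with hw
  -- termwise bound
  have key : ∀ y₁ y₂, |K₁ y y₁ * K₂ y₁ y₂ * K₃ y₂ y'| ≤ M * (w y y₁ * (w y₁ y₂ * w y₂ y')) := by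
    intro y₁ y₂
    have h1p : 0 < ℓ y₁ := hℓ y₁
    have h2p : 0 < ℓ y₂ := hℓ y₂
    have E₁ := hdist y y₁
    have E₂ := hdist y₁ y₂
    have E₃ := hdist y₂ y'
    have hy1 : 0 ≤ ℓ y ^ (1 : ℝ) := Real.rpow_nonneg (le_of_lt hy) _
    have hy14 : 0 ≤ ℓ y₁ ^ (-(4 : ℝ)) := Real.rpow_nonneg (le_of_lt h1p) _
    have hy2d : 0 ≤ ℓ y₂ ^ (-(d : ℝ)) := Real.rpow_nonneg (le_of_lt h2p) _
    have hym4 : 0 ≤ ℓ y ^ (-(4 : ℝ)) := Real.rpow_nonneg (le_of_lt hy) _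
    -- the three kernel bounds, with the scales transferred to the end-points
    have b1 := hK₁ y y₁
    have t4 : ℓ y₁ ^ (-(4 : ℝ)) ≤ A₄ * Real.exp (ε * dist y y₁) * ℓ y ^ (-(4 : ℝ)) := hT₄ y y₁
    have td : ℓ y₂ ^ (-(d : ℝ)) ≤ Ad * Real.exp (ε * dist y₂ y') * ℓ y' ^ (-(d : ℝ)) := hTd y₂ y'
    have t1 : ℓ y' ^ (1 : ℝ) ≤ A₁ * Real.exp (ε * (dist y y₁ + dist y₁ y₂ + dist y₂ y')) * ℓ y ^ (1 : ℝ) := by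
      have h := hT₁ y y'
      have hd : dist y y' ≤ dist y y₁ + dist y₁ y₂ + dist y₂ y' :=
        le_trans (htri y y₁ y') (by linarith [htri y₁ y₂ y'])
      have he : Real.exp (ε * dist y y') ≤ Real.exp (ε * (dist y y₁ + dist y₁ y₂ + dist y₂ y')) :=
        Real.exp_le_exp.mpr (mul_le_mul_of_nonneg_left hd hε)
      exact h.trans (mul_le_mul_of_nonneg_right (mul_le_mul_of_nonneg_left he hA₁) hy1)
    have b2 : |K₂ y₁ y₂| ≤ C₂ * (A₄ * Real.exp (ε * dist y y₁) * ℓ y ^ (-(4 : ℝ))) *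
        (Ad * Real.exp (ε * dist y₂ y') * ℓ y' ^ (-(d : ℝ))) * Real.exp (-(b * dist y₁ y₂)) := by
      refine (hK₂ y₁ y₂).trans ?_
      have : C₂ * ℓ y₁ ^ (-(4 : ℝ)) * ℓ y₂ ^ (-(d : ℝ)) ≤
          C₂ * (A₄ * Real.exp (ε * dist y y₁) * ℓ y ^ (-(4 : ℝ))) *
            (Ad * Real.exp (ε * dist y₂ y') * ℓ y' ^ (-(d : ℝ))) :=
        mul_le_mul (mul_le_mul_of_nonneg_left t4 hC₂) td hy2d (by positivity)
      exact mul_le_mul_of_nonneg_right this (Real.exp_nonneg _)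
    have b3 : |K₃ y₂ y'| ≤ C₃ * (A₁ * Real.exp (ε * (dist y y₁ + dist y₁ y₂ + dist y₂ y')) * ℓ y ^ (1 : ℝ)) *
        Real.exp (-(c * dist y₂ y')) := by
      refine (hK₃ y₂ y').trans ?_
      exact mul_le_mul_of_nonneg_right (mul_le_mul_of_nonneg_left t1 hC₃) (Real.exp_nonneg _)
    -- multiply the three bounds
    have prod : |K₁ y y₁ * K₂ y₁ y₂ * K₃ y₂ y'| ≤
        (C₁ * ℓ y ^ (1 : ℝ) * Real.exp (-(a * dist y y₁))) *
        (C₂ * (A₄ * Real.exp (ε * dist y y₁) * ℓ y ^ (-(4 : ℝ))) *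
          (Ad * Real.exp (ε * dist y₂ y') * ℓ y' ^ (-(d : ℝ))) * Real.exp (-(b * dist y₁ y₂))) *
        (C₃ * (A₁ * Real.exp (ε * (dist y y₁ + dist y₁ y₂ + dist y₂ y')) * ℓ y ^ (1 : ℝ)) *
          Real.exp (-(c * dist y₂ y'))) := by
      rw [abs_mul, abs_mul]
      apply mul_le_mul (mul_le_mul b1 b2 (abs_nonneg _) (by positivity)) b3 (abs_nonneg _)
      positivity
    -- collect: the scale powers ℓ(y)¹ ℓ(y)^{−4} ℓ(y)¹ = ℓ(y)^{−2} and the exponentials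
    have hpow : ℓ y ^ (1 : ℝ) * ℓ y ^ (-(4 : ℝ)) * ℓ y ^ (1 : ℝ) = ℓ y ^ (-(2 : ℝ)) := by
      rw [← Real.rpow_add hy, ← Real.rpow_add hy]; norm_num
    have hexp : Real.exp (-(a * dist y y₁)) * Real.exp (ε * dist y y₁) * Real.exp (ε * dist y₂ y') *
        Real.exp (-(b * dist y₁ y₂)) * Real.exp (ε * (dist y y₁ + dist y₁ y₂ + dist y₂ y')) *
        Real.exp (-(c * dist y₂ y')) ≤ w y y₁ * (w y₁ y₂ * w y₂ y') := by
      rw [hw]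
      simp only [← Real.exp_add]
      apply Real.exp_le_exp.mpr
      have i1 := mul_le_mul_of_nonneg_right ha E₁
      have i2 := mul_le_mul_of_nonneg_right hb E₂
      have i3 := mul_le_mul_of_nonneg_right hc E₃
      nlinarith
    calc |K₁ y y₁ * K₂ y₁ y₂ * K₃ y₂ y'|
        ≤ _ := prod
      _ = (C₁ * C₂ * C₃ * A₄ * Ad * A₁ * (ℓ y ^ (1 : ℝ) * ℓ y ^ (-(4 : ℝ)) * ℓ y ^ (1 : ℝ)) *
            ℓ y' ^ (-(d : ℝ))) *
          (Real.exp (-(a * dist y y₁)) * Real.exp (ε * dist y y₁) * Real.exp (ε * dist y₂ y') *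
            Real.exp (-(b * dist y₁ y₂)) * Real.exp (ε * (dist y y₁ + dist y₁ y₂ + dist y₂ y')) *
            Real.exp (-(c * dist y₂ y'))) := by ring
      _ = M * (Real.exp (-(a * dist y y₁)) * Real.exp (ε * dist y y₁) * Real.exp (ε * dist y₂ y') *
            Real.exp (-(b * dist y₁ y₂)) * Real.exp (ε * (dist y y₁ + dist y₁ y₂ + dist y₂ y')) *
            Real.exp (-(c * dist y₂ y'))) := by rw [hpow, hM]
      _ ≤ M * (w y y₁ * (w y₁ y₂ * w y₂ y')) := mul_le_mul_of_nonneg_left hexp hMnn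
  -- sum over the two intermediate points and convolve
  have hconv : ∑ y₁, w y y₁ * ∑ y₂, w y₁ y₂ * w y₂ y' ≤ Cc * Real.exp (-(θ * dist y y')) := by
    have h := hConv y y'
    simpa [hw] using h
  calc |∑ y₁, ∑ y₂, K₁ y y₁ * K₂ y₁ y₂ * K₃ y₂ y'|
      ≤ ∑ y₁, |∑ y₂, K₁ y y₁ * K₂ y₁ y₂ * K₃ y₂ y'| := Finset.abs_sum_le_sum_abs _ _
    _ ≤ ∑ y₁, ∑ y₂, |K₁ y y₁ * K₂ y₁ y₂ * K₃ y₂ y'| :=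
        Finset.sum_le_sum fun y₁ _ => Finset.abs_sum_le_sum_abs _ _
    _ ≤ ∑ y₁, ∑ y₂, M * (w y y₁ * (w y₁ y₂ * w y₂ y')) :=
        Finset.sum_le_sum fun y₁ _ => Finset.sum_le_sum fun y₂ _ => key y₁ y₂
    _ = M * ∑ y₁, w y y₁ * ∑ y₂, w y₁ y₂ * w y₂ y' := by
        simp only [Finset.mul_sum]
    _ ≤ M * (Cc * Real.exp (-(θ * dist y y'))) := mul_le_mul_of_nonneg_left hconv hMnn
    _ = C₁ * C₂ * C₃ * A₄ * Ad * A₁ * Cc * ℓ y ^ (-(2 : ℝ)) * ℓ y' ^ (-(d : ℝ)) *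
          Real.exp (-(θ * dist y y')) := by rw [hM]; ring

/-- The two-intermediate-point convolution hypothesis IS the m = 2 instance of the tree's typed (2.63)
(`B6RandomWalk.Ineq263`): `C_c = c₁(α)³`, `θ = (1−α)δ₀`. [cite: Balaban1984PropagatorsII, Lemma 2.1 (2.63) p.234] -/
theorem conv3_of_ineq263 (d : ℕ) (g : B6.Geometry) (δ₀ α : ℝ) (h : B6RandomWalk.Ineq263 d g δ₀ α) :
    Conv3 g.dist δ₀ (B6.c1 d δ₀ α ^ 3) ((1 - α) * δ₀) := by
  intro y y'
  have h2 := h 2 y y'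
  simpa [B6RandomWalk.chain] using h2

/-- **(2.88) over the carrier of `…B6`, from the tree's typed Lemma 2.1.**  For a geometry of a family satisfying
`B6.Lemma21Printed d δ geo` at a rate `δ ≥ 0` and the triangle inequality (2.54), under (2.1)–(2.2), 0 < α < 1,
(2.59), `1 ≤ L`, `0 < η`, `d(·,·) ≥ 0` and the largeness `L⁴, L^d, L ≤ e^{αδRM}`: three kernels bounded as in the
first inequality of (2.88) with rates `a, b, c` (printed: ½δ₀, ½δ₁, ½δ₀) satisfying `(1+2α)δ ≤ a`, `(1+α)δ ≤ b`,
`(1+2α)δ ≤ c` compose to the printed right-hand side with `δ₂ = (1−α)δ` and `O(1) = C₁C₂C₃·L⁴·L^d·L·c₁(α)³`.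
The scale transfers ((2.60), `transfer_of_260`) and the convolution ((2.63), `conv3_of_ineq263` ∘
`B6RandomWalk.ineq263_of_261`) are DISCHARGED. [cite: Balaban1984PropagatorsII, (2.88) p.238; Lemma 2.1 p.234] -/
theorem ineq288_of_lemma21 {I : Type} (d : ℕ) (δ : ℝ) (hδ : 0 ≤ δ) (geo : I → B6.Geometry)
    (h21 : B6.Lemma21Printed d δ geo) (i : I) (htri : B6RandomWalk.Triangle254 (geo i))
    (hH : (geo i).Hyp21_22) (α : ℝ) (hα0 : 0 < α) (hα1 : α < 1)
    (h259 : B6.Cond259 d δ α (geo i).R (geo i).M) (hL : 1 ≤ (geo i).L) (hη : 0 < (geo i).eta)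
    (hl4 : (geo i).L ^ (4 : ℝ) ≤ Real.exp (α * δ * (geo i).R * (geo i).M))
    (hld : (geo i).L ^ (d : ℝ) ≤ Real.exp (α * δ * (geo i).R * (geo i).M))
    (hl1 : (geo i).L ^ (1 : ℝ) ≤ Real.exp (α * δ * (geo i).R * (geo i).M))
    (hdist : ∀ y y', 0 ≤ (geo i).dist y y')
    (K₁ K₂ K₃ : (geo i).Site → (geo i).Site → ℝ) (C₁ C₂ C₃ a b c : ℝ)
    (hC₁ : 0 ≤ C₁) (hC₂ : 0 ≤ C₂) (hC₃ : 0 ≤ C₃)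
    (ha : δ + 2 * (α * δ) ≤ a) (hb : δ + α * δ ≤ b) (hc : δ + 2 * (α * δ) ≤ c)
    (hK₁ : ∀ y y₁, |K₁ y y₁| ≤ C₁ * (geo i).len y ^ (1 : ℝ) * Real.exp (-(a * (geo i).dist y y₁)))
    (hK₂ : ∀ y₁ y₂, |K₂ y₁ y₂| ≤ C₂ * (geo i).len y₁ ^ (-(4 : ℝ)) * (geo i).len y₂ ^ (-(d : ℝ)) *
      Real.exp (-(b * (geo i).dist y₁ y₂)))
    (hK₃ : ∀ y₂ y', |K₃ y₂ y'| ≤ C₃ * (geo i).len y' ^ (1 : ℝ) * Real.exp (-(c * (geo i).dist y₂ y'))) :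
    ∀ y y' : (geo i).Site, |comp3 K₁ K₂ K₃ y y'| ≤
      C₁ * C₂ * C₃ * (geo i).L ^ (4 : ℝ) * (geo i).L ^ (d : ℝ) * (geo i).L ^ (1 : ℝ) * B6.c1 d δ α ^ 3 *
        (geo i).len y ^ (-(2 : ℝ)) * (geo i).len y' ^ (-(d : ℝ)) *
        Real.exp (-((1 - α) * δ * (geo i).dist y y')) := by
  intro y y'
  have h260 := (h21 i hH α hα0 hα1 h259).1
  have h261 := (h21 i hH α hα0 hα1 h259).2
  have h263 := B6RandomWalk.ineq263_of_261 d (geo i) δ α htri hδ hα1.le h261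
  have hconv := conv3_of_ineq263 d (geo i) δ α h263
  have hL0 : 0 ≤ (geo i).L := le_trans zero_le_one hL
  -- the three transfers, constants L^{|−4|} = L⁴, L^{|−d|} = L^d, L^{|1|} = L
  have e4 : |(-(4 : ℝ))| = 4 := by norm_num
  have ed : |(-(d : ℝ))| = (d : ℝ) := by rw [abs_neg]; exact abs_of_nonneg (Nat.cast_nonneg d)
  have e1 : |(1 : ℝ)| = 1 := abs_one
  have hT₄ := (transfer_of_260 (geo i).scale (geo i).dist (geo i).L (geo i).eta (α * δ) (geo i).R (geo i).M
    (-(4 : ℝ)) hL hη (by rw [e4]; exact hl4) h260).2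
  have hTd := (transfer_of_260 (geo i).scale (geo i).dist (geo i).L (geo i).eta (α * δ) (geo i).R (geo i).M
    (-(d : ℝ)) hL hη (by rw [ed]; exact hld) h260).1
  have hT₁ := (transfer_of_260 (geo i).scale (geo i).dist (geo i).L (geo i).eta (α * δ) (geo i).R (geo i).M
    (1 : ℝ) hL hη (by rw [e1]; exact hl1) h260).2
  rw [e4] at hT₄
  rw [ed] at hTd
  rw [e1] at hT₁
  rw [← len_eq_rpow] at hT₄ hTd hT₁
  have hε : 0 ≤ α * δ := mul_nonneg hα0.le hδ
  exact ineq288_kernel (geo i).len (geo i).dist d K₁ K₂ K₃ C₁ C₂ C₃ a b c (α * δ) δ ((geo i).L ^ (4 : ℝ))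
    ((geo i).L ^ (d : ℝ)) ((geo i).L ^ (1 : ℝ)) (B6.c1 d δ α ^ 3) ((1 - α) * δ) (len_pos (geo i) hL hη) hdist
    htri hC₁ hC₂ hC₃ (Real.rpow_nonneg hL0 _) (Real.rpow_nonneg hL0 _) (Real.rpow_nonneg hL0 _) hε ha hb hc
    hK₁ hK₂ hK₃ hT₄ hTd hT₁ hconv y y'

/-- The right-hand side of (2.88) p. 238 as a property of three site kernels over the carrier of `…B6`:
*"≤ O(1)(L^jη)^{−2}(L^{j′}η)^{−d}e^{−δ₂d(y,y′)}, (2.88) … y ∈ Λ_j, y′ ∈ Λ_{j′}"* for the plain double sum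
`Σ_{y₁,y₂∈𝔅} K₁(y,y₁)K₂(y₁,y₂)K₃(y₂,y′)`, with the O(1) a named constant `C` and the rate `δ₂` a parameter.
[cite: Balaban1984PropagatorsII, (2.88) p.238] -/
def Ineq288 (g : B6.Geometry) (d : ℕ) (K₁ K₂ K₃ : g.Site → g.Site → ℝ) (C δ₂ : ℝ) : Prop :=
  ∀ y y', |comp3 K₁ K₂ K₃ y y'| ≤
    C * g.len y ^ (-(2 : ℝ)) * g.len y' ^ (-(d : ℝ)) * Real.exp (-(δ₂ * g.dist y y'))

/-- `ineq288_of_lemma21` in the shape `Ineq288`: δ₂ = (1−α)δ, O(1) = C₁C₂C₃·L⁴·L^d·L·c₁(α)³.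
[cite: Balaban1984PropagatorsII, (2.88) p.238; Lemma 2.1 p.234] -/
theorem ineq288_printed_of_lemma21 {I : Type} (d : ℕ) (δ : ℝ) (hδ : 0 ≤ δ) (geo : I → B6.Geometry)
    (h21 : B6.Lemma21Printed d δ geo) (i : I) (htri : B6RandomWalk.Triangle254 (geo i))
    (hH : (geo i).Hyp21_22) (α : ℝ) (hα0 : 0 < α) (hα1 : α < 1)
    (h259 : B6.Cond259 d δ α (geo i).R (geo i).M) (hL : 1 ≤ (geo i).L) (hη : 0 < (geo i).eta)
    (hl4 : (geo i).L ^ (4 : ℝ) ≤ Real.exp (α * δ * (geo i).R * (geo i).M))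
    (hld : (geo i).L ^ (d : ℝ) ≤ Real.exp (α * δ * (geo i).R * (geo i).M))
    (hl1 : (geo i).L ^ (1 : ℝ) ≤ Real.exp (α * δ * (geo i).R * (geo i).M))
    (hdist : ∀ y y', 0 ≤ (geo i).dist y y')
    (K₁ K₂ K₃ : (geo i).Site → (geo i).Site → ℝ) (C₁ C₂ C₃ a b c : ℝ)
    (hC₁ : 0 ≤ C₁) (hC₂ : 0 ≤ C₂) (hC₃ : 0 ≤ C₃)
    (ha : δ + 2 * (α * δ) ≤ a) (hb : δ + α * δ ≤ b) (hc : δ + 2 * (α * δ) ≤ c)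
    (hK₁ : ∀ y y₁, |K₁ y y₁| ≤ C₁ * (geo i).len y ^ (1 : ℝ) * Real.exp (-(a * (geo i).dist y y₁)))
    (hK₂ : ∀ y₁ y₂, |K₂ y₁ y₂| ≤ C₂ * (geo i).len y₁ ^ (-(4 : ℝ)) * (geo i).len y₂ ^ (-(d : ℝ)) *
      Real.exp (-(b * (geo i).dist y₁ y₂)))
    (hK₃ : ∀ y₂ y', |K₃ y₂ y'| ≤ C₃ * (geo i).len y' ^ (1 : ℝ) * Real.exp (-(c * (geo i).dist y₂ y'))) :
    Ineq288 (geo i) d K₁ K₂ K₃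
      (C₁ * C₂ * C₃ * (geo i).L ^ (4 : ℝ) * (geo i).L ^ (d : ℝ) * (geo i).L ^ (1 : ℝ) * B6.c1 d δ α ^ 3)
      ((1 - α) * δ) :=
  fun y y' => ineq288_of_lemma21 d δ hδ geo h21 i htri hH α hα0 hα1 h259 hL hη hl4 hld hl1 hdist K₁ K₂ K₃
    C₁ C₂ C₃ a b c hC₁ hC₂ hC₃ ha hb hc hK₁ hK₂ hK₃ y y'

end Literature.MathematicalPhysics.QuantumFieldTheory.Balaban1983to89.B6Cor28
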